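import Summits.AnomalousDissipation.AnomalousDissipation.Theorems.SolenoidalFractalHomogenisationLagrangianStepD1TailCrushOldState
import Summits.AnomalousDissipation.AnomalousDissipation.Theorems.SolenoidalFractalHomogenisationLagrangianStepD1TailCrushDecomp
import HarnessLib

/-!
# K1L_D `stub_D1_V0thg` (stmt-AnomalousDissipation-27980), R3′ lane, R3′-2 `D1TailCrushBound`: THE ZERO CLASS, CRUSHED — a pickup slot reached
# from the source through STATIC slots only reads the crushed old memory (helper; `--supports stmt-AnomalousDissipation-27980 --as helper`)

Helper file of route `SolenoidalFractalHomogenisation` (one-generation hand `leafhand-ad-solenoidalfractalh-1` g1, road E-c).  The R3′ plan memo's ZERO class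
(`Lines/onelevel-vtheta-R3-plan.md` §2): pickup `j ≠ j'`, no slot strictly between `j'` and `j` hops `m_{j'}`, `mⱼ ∦ m_{j'}` (the non-partner case of
`LadderCrush.pair_census` without an intermediate hopper).  Then the memory deposited on `± m_{j'}` sits on the two ladders `± m_{j'} + ℤmⱼ` during the whole
pickup slot (they are invariant there, `…SidebandCrushedResponse` §3) and these ladders avoid the read fibres `± mⱼ`; the pickup reads only the complement, i.e. the
OLD memory `maskL Tᶜ`, which contracted from the state at the source start — the CRUSHED OLD STATE (`D1Tail.crushed_old_state`).  Contents:
* §1 (any word) `Sideband.not_mem_ladders_of_not_colinear`; **`Sideband.norm_coordL_responseExt_le_of_static`** — for `w ∉ L₊ ∪ L₋` and `t` in a one-slot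
  window `[s, e]` of slot `i` (source off, static links on `[a, s)`): `‖(N̄ t v)_w‖ ≤ ‖N̄ a v‖`;
* §2 (cubature word) **`tail_bound_far_core_eps'`** — the variant of `tail_bound_far_core_eps` whose hypothesis bounds only the two READ COORDINATES
  `(N̄ t qC)_{± mⱼ}` along the pickup slot;
* §3 **`tail_bound_zero_class_eps`** — for `j ≠ j'` non-colinear without fresh part and all cyclically intermediate slots static:
  `|tailKernel ν S p q j j'| ≤ C·√ν·gTail j j'·(…)`, `ν = r³ ≤ r₁³`.
What is NOT here: the crushed-class pairs (first hopper strictly between source and pickup; `crushed_state_after` + `tail_bound_far_core_eps` with the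
period placement of the pickup window) and the assembly over the 676 pairs.  No definitions, no sorry.  NOT a proof of `stub_D1_V0thg`, of K1L_D or of AD.
-/

set_option linter.dupNamespace false

noncomputable section

namespace Summit.AnomalousDissipation.AnomalousDissipation.Theorems.SolenoidalFractalHomogenisation.LagrangianStep.Sideband

open Set Complex MeasureTheory
open scoped InnerProductSpace
open Literature.Analysis Literature.Analysis.FunctionSpaces Literature.Analysis.FunctionSpaces.Torus
open Literature.Analysis.FluidPDE Literature.Analysis.FluidPDE.Torus Literature.Analysis.FluidPDE.LatticeShear
open Summit.AnomalousDissipation.AnomalousDissipation.Theorems.SolenoidalFractalHomogenisation.LagrangianStep.CellChain (linkCoeff)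
open Summit.AnomalousDissipation.AnomalousDissipation.Theorems.SolenoidalFractalHomogenisation.PermissibleCarrier (period_pos)

variable {k₀ : ℕ}

/-! ## §1 The read fibres avoid the source ladders; the read coordinates see only the old memory -/

/-- `± m ∉ (m' + ℤm) ∪ (−m' + ℤm)` when `m' ∉ ℤm`. [folklore] -/
theorem not_mem_ladders_of_not_colinear {m m' : Fin 3 → ℤ} (hnc : ∀ c : ℤ, m' ≠ c • m) :
    m ∉ ladder m' m ∪ ladder (-m') m ∧ -m ∉ ladder m' m ∪ ladder (-m') m := by
  have key : ∀ c : ℤ, m' = (c : Fin 3 → ℤ) * m → False := fun c h => hnc c (by rw [zsmul_eq_mul]; exact h)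
  refine ⟨?_, ?_⟩
  · rintro (⟨k, hk⟩ | ⟨k, hk⟩) <;> rw [zsmul_eq_mul] at hk
    · exact key (1 - k) (by push_cast; linear_combination -hk)
    · exact key (k - 1) (by push_cast; linear_combination hk)
  · rintro (⟨k, hk⟩ | ⟨k, hk⟩) <;> rw [zsmul_eq_mul] at hk
    · exact key (-1 - k) (by push_cast; linear_combination -hk)
    · exact key (k + 1) (by push_cast; linear_combination hk)

/-- **THE READ COORDINATES SEE ONLY THE OLD MEMORY.**  Word `W₁`, `NearIso 𝔸 lo' hi'` (`lo' > 0`), `γ₁ > 0`, source slot `j` (fibres `± m_j`), a one-slot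
window `[s, e]` of slot `i` on which the source of `j` is off, static links on `[a, s)` (no active link joins `{± m_j}` to a retained fibre outside it), and a
lattice point `w` OFF the two ladders `± m_j + ℤmᵢ`.  Then for every `t ∈ [s, e]`: `‖(N̄ t v)_w‖ ≤ ‖N̄ a v‖` (indeed `≤ e^{−r(s−a)}‖N̄ a v‖`).
[cite: MajdaKramer1999, §2.2.1.3 (cell problem (49))] [cite: SandersVerhulstMurdock2007, Lemma 5.2.7 (linear case)] -/
theorem norm_coordL_responseExt_le_of_static (W₁ : LatticeWord k₀) {𝔸 : Torus.Visc4 (Fin 3)} {lo' hi' : ℝ} (h𝔸 : Torus.NearIso 𝔸 lo' hi')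
    (hlo' : 0 < lo') {γ₁ : ℝ} (hγ₁ : 0 < γ₁) (R : ℕ) (j i : Fin k₀) (v : EuclideanSpace ℂ (Fin 3))
    {a s e : ℝ} (has : a ≤ s)
    (hstatic : ∀ t ∈ Ico a s, ∀ (l : Fin k₀) (z : box R), (z : Fin 3 → ℤ) ≠ (W₁.phase j).m → (z : Fin 3 → ℤ) ≠ -(W₁.phase j).m →
      ∀ w : Fin 3 → ℤ, (w = z.1 - (W₁.phase l).m ∨ w = z.1 + (W₁.phase l).m) → w ∈ box R →
      (w = (W₁.phase j).m ∨ w = -(W₁.phase j).m) → linkCoeff W₁ 1 z.1 l t = 0)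
    (hsrc : ∀ t ∈ Icc s e, slotEnvelope W₁ j t = 0) (hoff : ∀ t ∈ Icc s e, ∀ l, l ≠ i → slotEnvelope W₁ l t = 0)
    {w : Fin 3 → ℤ} (hw : w ∉ ladder (W₁.phase j).m (W₁.phase i).m ∪ ladder (-(W₁.phase j).m) (W₁.phase i).m) :
    ∀ t ∈ Icc s e, ‖coordL R w (responseExt W₁ 𝔸 γ₁ R j t v)‖ ≤ ‖responseExt W₁ 𝔸 γ₁ R j a v‖ := by
  intro t ht
  have hN := isPeriodicResponse_response_of_nearIso W₁ h𝔸 hlo' hγ₁ R j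
  have hTL : ({z | z = (W₁.phase j).m ∨ z = -(W₁.phase j).m} : Set (Fin 3 → ℤ)) ⊆
      ladder (W₁.phase j).m (W₁.phase i).m ∪ ladder (-(W₁.phase j).m) (W₁.phase i).m := by
    rintro z (hz | hz)
    · rw [mem_union]; left; rw [hz]; exact self_mem_ladder _ _
    · rw [mem_union]; right; rw [hz]; exact self_mem_ladder _ _
  -- the read coordinate only sees the complement of the two ladders
  have hread : coordL R w (responseExt W₁ 𝔸 γ₁ R j t v) =
      coordL R w (maskL R (ladder (W₁.phase j).m (W₁.phase i).m ∪ ladder (-(W₁.phase j).m) (W₁.phase i).m)ᶜ (responseExt W₁ 𝔸 γ₁ R j t v)) :=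
    (coordL_maskL_of_mem (mem_compl hw) _).symm
  -- the complement is a solution on `[s, t]` and contracts
  have hsol := hasDerivAt_maskL_responseExt_of_slot W₁ 𝔸 γ₁ R j i hN v
    (compl_closed_of_closed (union_ladder_closed (W₁.phase j).m (-(W₁.phase j).m) (W₁.phase i).m))
    (fun u hu => hsrc u ⟨hu.1, hu.2.trans ht.2⟩) (fun u hu => hoff u ⟨hu.1, hu.2.trans ht.2⟩)
  have hcontr := norm_le_of_hasDerivAt_gen W₁ h𝔸 hlo'.le hγ₁.le R ht.1 hsol
  -- at `s` the complement sits inside the old memory `maskL Tᶜ`, which contracted from `a`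
  have hold := norm_maskL_responseExt_le_exp W₁ h𝔸 hlo'.le γ₁ R j hN {z | z = (W₁.phase j).m ∨ z = -(W₁.phase j).m}ᶜ v has
    (fun u hu l z hz w' hw' hwb hwT => hstatic u hu l z (fun h => hz (Or.inl h)) (fun h => hz (Or.inr h)) w' hw' hwb (not_not.1 hwT))
    (fun u _ => maskL_source_eq_zero W₁ R j u v (fun h => h (Or.inl rfl)) (fun h => h (Or.inr rfl)))
  have hexp : Real.exp (-(min γ₁ (4 * Real.pi ^ 2 * lo') * (s - a))) ≤ 1 := by
    rw [Real.exp_le_one_iff, neg_nonpos]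
    exact mul_nonneg (le_min hγ₁.le (by positivity)) (sub_nonneg.2 has)
  calc ‖coordL R w (responseExt W₁ 𝔸 γ₁ R j t v)‖
      = ‖coordL R w (maskL R (ladder (W₁.phase j).m (W₁.phase i).m ∪ ladder (-(W₁.phase j).m) (W₁.phase i).m)ᶜ (responseExt W₁ 𝔸 γ₁ R j t v))‖ := by
        rw [hread]
    _ ≤ ‖maskL R (ladder (W₁.phase j).m (W₁.phase i).m ∪ ladder (-(W₁.phase j).m) (W₁.phase i).m)ᶜ (responseExt W₁ 𝔸 γ₁ R j t v)‖ := norm_coordL_le _ _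
    _ ≤ ‖maskL R (ladder (W₁.phase j).m (W₁.phase i).m ∪ ladder (-(W₁.phase j).m) (W₁.phase i).m)ᶜ (responseExt W₁ 𝔸 γ₁ R j s v)‖ := hcontr
    _ ≤ ‖maskL R {z | z = (W₁.phase j).m ∨ z = -(W₁.phase j).m}ᶜ (responseExt W₁ 𝔸 γ₁ R j s v)‖ :=
        norm_maskL_le_of_subset (compl_subset_compl.2 hTL) _
    _ ≤ Real.exp (-(min γ₁ (4 * Real.pi ^ 2 * lo') * (s - a))) * ‖maskL R {z | z = (W₁.phase j).m ∨ z = -(W₁.phase j).m}ᶜ (responseExt W₁ 𝔸 γ₁ R j a v)‖ := hold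
    _ ≤ 1 * ‖responseExt W₁ 𝔸 γ₁ R j a v‖ := mul_le_mul hexp (norm_maskL_le _ _) (norm_nonneg _) zero_le_one
    _ = ‖responseExt W₁ 𝔸 γ₁ R j a v‖ := one_mul _

end Summit.AnomalousDissipation.AnomalousDissipation.Theorems.SolenoidalFractalHomogenisation.LagrangianStep.Sideband

namespace Summit.AnomalousDissipation.AnomalousDissipation.Theorems.SolenoidalFractalHomogenisation.LagrangianStep.D1Tail

open Summit.AnomalousDissipation.AnomalousDissipation.Theorems
open Summit.AnomalousDissipation.AnomalousDissipation.Theorems.SolenoidalFractalHomogenisation.LagrangianStep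
open Summit.AnomalousDissipation.AnomalousDissipation.Theorems.SolenoidalFractalHomogenisation.LagrangianStep.WCrossing
open Summit.AnomalousDissipation.AnomalousDissipation.Theorems.SolenoidalFractalHomogenisation.LagrangianStep.D1ResidueCert
open Summit.AnomalousDissipation.AnomalousDissipation.Theorems.SolenoidalFractalHomogenisation.LagrangianStep.D1TailCert
open Summit.AnomalousDissipation.AnomalousDissipation.Theorems.SolenoidalFractalHomogenisation.LagrangianStep.Sideband
open Summit.AnomalousDissipation.AnomalousDissipation.Theorems.SolenoidalFractalHomogenisation.LagrangianStep.CellChain (start_stretch_stretch)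
open Summit.AnomalousDissipation.AnomalousDissipation.Theorems.SolenoidalFractalHomogenisation.PermissibleCarrier
  (period_pos start_nonneg start_add_tau_le_period)
open Summit.AnomalousDissipation.AnomalousDissipation.Theorems.SolenoidalFractalHomogenisation.RealisedQuasiStaticCellLaw (start_add_tau_le_start)
open Literature.Analysis Literature.Analysis.FluidPDE Literature.Analysis.FunctionSpaces Literature.Analysis.FunctionSpaces.Torus
open Literature.Analysis.FluidPDE.Torus Literature.Analysis.FluidPDE.LatticeShear
open Set Real Complex MeasureTheory intervalIntegral
open scoped InnerProductSpace

/-! ## §2 The far-pair core from bounds of the two read coordinates -/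

set_option maxHeartbeats 400000 in -- pre-budgeted (ops-buildfix rule): the flat far-pair core with coordinate bounds
/-- **FAR-PAIR CORE BOUND from the READ COORDINATES (ε-form).**  As `tail_bound_far_core_eps`, but the hypothesis bounds only the two coordinates
`(N̄ t qC)_{± mⱼ}` read by the pickup of slot `j` along its window (the ZERO class needs this: the rest of the state is not small).
[cite: ArmstrongVicol2025, §3] [cite: SandersVerhulstMurdock2007, Lemma 5.2.7] -/
theorem tail_bound_far_core_eps' {ν : ℝ} (hν : ν ∈ Ioc (0:ℝ) (1 / 40)) {S : T4} (hS : Torus.NearIso S (10 / 11) (11 / 10)) (p q : Fin 3 → ℝ)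
    {j j' : Fin 26} (hfresh : freshMat S j j' = 0) (ε : ℝ)
    (hcr : ∀ t ∈ Icc (((cubatureWord.stretch MB MB_pos).stretch (1 / ν) (one_div_pos.mpr hν.1)).start j)
      (((cubatureWord.stretch MB MB_pos).stretch (1 / ν) (one_div_pos.mpr hν.1)).start j +
        (((cubatureWord.stretch MB MB_pos).stretch (1 / ν) (one_div_pos.mpr hν.1)).phase j).τ),
      ‖coordL (R0 ν) (-(((cubatureWord.stretch MB MB_pos).stretch (1 / ν) (one_div_pos.mpr hν.1)).phase j).m)
          (responseExt ((cubatureWord.stretch MB MB_pos).stretch (1 / ν) (one_div_pos.mpr hν.1)) (ν • S) 1 (R0 ν) j' t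
          (WithLp.toLp 2 fun i => ((q i : ℝ) : ℂ)))‖ ≤
        ε * (8 * π * ‖slotAmp ((cubatureWord.stretch MB MB_pos).stretch (1 / ν) (one_div_pos.mpr hν.1)) j'‖ /
          min (1:ℝ) (4 * π ^ 2 * (ν * (10 / 11))) * ‖transversalProj (cubatureWord.phase j').m (WithLp.toLp 2 fun i => ((q i : ℝ) : ℂ) : EuclideanSpace ℂ (Fin 3))‖) ∧
      ‖coordL (R0 ν) (((cubatureWord.stretch MB MB_pos).stretch (1 / ν) (one_div_pos.mpr hν.1)).phase j).m
          (responseExt ((cubatureWord.stretch MB MB_pos).stretch (1 / ν) (one_div_pos.mpr hν.1)) (ν • S) 1 (R0 ν) j' t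
          (WithLp.toLp 2 fun i => ((q i : ℝ) : ℂ)))‖ ≤
        ε * (8 * π * ‖slotAmp ((cubatureWord.stretch MB MB_pos).stretch (1 / ν) (one_div_pos.mpr hν.1)) j'‖ /
          min (1:ℝ) (4 * π ^ 2 * (ν * (10 / 11))) * ‖transversalProj (cubatureWord.phase j').m (WithLp.toLp 2 fun i => ((q i : ℝ) : ℂ) : EuclideanSpace ℂ (Fin 3))‖)) :
    |tailKernel ν S p q j j'| ≤ ε * Real.exp θmin * gTail j j' * (Real.sqrt (PpSq j p) * Real.sqrt (PpSq j' q)) := by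
  obtain ⟨hν0, hν40⟩ := hν
  set W₁ := (cubatureWord.stretch MB MB_pos).stretch (1 / ν) (one_div_pos.mpr hν0) with hW₁
  have h𝔸 : Torus.NearIso (ν • S) (ν * (10 / 11)) (ν * (11 / 10)) := hS.smul hν0.le
  have hlo : 0 < ν * (10 / 11) := by positivity
  set r := min (1:ℝ) (4 * π ^ 2 * (ν * (10 / 11))) with hr
  have hNj' := isPeriodicResponse_cubature hν0 hS j'
  set N := response W₁ (ν • S) 1 (R0 ν) j' with hNdef
  set Nb := responseExt W₁ (ν • S) 1 (R0 ν) j' with hNb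
  set pC : EuclideanSpace ℂ (Fin 3) := WithLp.toLp 2 fun i => ((p i : ℝ) : ℂ) with hpC
  set qC : EuclideanSpace ℂ (Fin 3) := WithLp.toLp 2 fun i => ((q i : ℝ) : ℂ) with hqC
  set s := W₁.start j with hs
  set L := (W₁.phase j).τ with hL
  have hLpos : 0 < L := (W₁.phase j).τ_pos
  have hs0 : 0 ≤ s := start_nonneg W₁ j
  have hsP : s + L ≤ W₁.period := start_add_tau_le_period W₁ j
  -- state / pickup constants
  set SUP : ℝ := 8 * π * ‖slotAmp W₁ j'‖ / r * ‖transversalProj (cubatureWord.phase j').m qC‖ with hSUP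
  set C : ℝ := 1 / (2 * ‖latticeVec (cubatureWord.phase j).m‖) * ‖transversalProj (cubatureWord.phase j).m pC‖ * (2 * (ε * SUP))
    with hC
  have hSUP0 : 0 ≤ SUP := by rw [hSUP]; positivity
  -- pointwise bound of the two read coordinates in the pickup slot (hypothesis)
  have hstate : ∀ t ∈ Icc s (s + L), ‖coordL (R0 ν) (-(W₁.phase j).m) (N t qC)‖ ≤ ε * SUP ∧ ‖coordL (R0 ν) (W₁.phase j).m (N t qC)‖ ≤ ε * SUP := by
    intro t ht
    have htP : t ∈ Icc 0 W₁.period := ⟨hs0.trans ht.1, ht.2.trans hsP⟩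
    rw [hNdef, response_eq_responseExt W₁ (ν • S) 1 (R0 ν) j' hNj' htP]
    exact hcr t ht
  -- pointwise pairing bound
  have hpt : ∀ t ∈ Set.uIoc s (s + L), ‖⟪pC, feedback W₁ (R0 ν) j t (N t qC)⟫_ℂ‖ ≤ C := by
    intro t ht
    rw [Set.uIoc_of_le (by linarith)] at ht
    have ht' : t ∈ Icc s (s + L) := ⟨ht.1.le, ht.2⟩
    have htP : t ∈ Icc 0 W₁.period := ⟨hs0.trans ht'.1, ht'.2.trans hsP⟩
    have hfa := transversalProj_coordL_response W₁ h𝔸 hlo one_pos (R := R0 ν) j' htP qC (W₁.phase j).m (-(W₁.phase j).m) (Or.inr rfl)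
    have hfb := transversalProj_coordL_response W₁ h𝔸 hlo one_pos (R := R0 ν) j' htP qC (W₁.phase j).m ((W₁.phase j).m) (Or.inl rfl)
    have hpick := norm_inner_feedback_le W₁ (R0 ν) j t pC (y := N t qC) hfa hfb
    have hy1 : ‖coordL (R0 ν) (-(W₁.phase j).m) (N t qC)‖ ≤ ε * SUP := (hstate t ht').1
    have hy2 : ‖coordL (R0 ν) (W₁.phase j).m (N t qC)‖ ≤ ε * SUP := (hstate t ht').2
    have h0 : 0 ≤ 1 / (2 * ‖latticeVec (W₁.phase j).m‖) * ‖transversalProj (W₁.phase j).m pC‖ := by positivity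
    calc ‖⟪pC, feedback W₁ (R0 ν) j t (N t qC)⟫_ℂ‖
        ≤ 1 / (2 * ‖latticeVec (W₁.phase j).m‖) * ‖transversalProj (W₁.phase j).m pC‖ *
            (‖coordL (R0 ν) (-(W₁.phase j).m) (N t qC)‖ + ‖coordL (R0 ν) (W₁.phase j).m (N t qC)‖) := hpick
      _ ≤ 1 / (2 * ‖latticeVec (W₁.phase j).m‖) * ‖transversalProj (W₁.phase j).m pC‖ * (2 * (ε * SUP)) :=
            mul_le_mul_of_nonneg_left (by linarith) h0
      _ = C := by rw [hC]; rfl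
  -- the pairing with the period mean
  have hI := intervalIntegrable_feedback_comp W₁ (ν • S) 1 (R0 ν) j j' hNj' hs0 (by linarith) hsP
  have hX : ∫ t in s..s + L, (((feedback W₁ (R0 ν) j t).restrictScalars ℝ).comp (N t)) qC = ∫ t in s..s + L, feedback W₁ (R0 ν) j t (N t qC) :=
    intervalIntegral.integral_congr fun t _ => rfl
  have hXint : IntervalIntegrable (fun t => feedback W₁ (R0 ν) j t (N t qC)) volume s (s + L) := by
    have h := ((continuousOn_feedback_comp W₁ (ν • S) 1 (R0 ν) j j' hNj').mono (Icc_subset_Icc hs0 hsP)).clm_apply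
      (continuousOn_const (c := qC))
    exact (h.congr fun t _ => rfl).intervalIntegrable_of_Icc (by linarith)
  have hM : meanFeedback W₁ (ν • S) 1 (R0 ν) j j' qC = (1 / W₁.period) • ∫ t in s..s + L, feedback W₁ (R0 ν) j t (N t qC) := by
    rw [meanFeedback_eq_slot_integral W₁ (ν • S) 1 (R0 ν) j j' ⟨_, hNj'⟩, _root_.smul_apply, ContinuousLinearMap.intervalIntegral_apply hI qC, hX]
  -- assemble through the common end game
  have h0 : (0 : Matrix (Fin 3) (Fin 3) ℝ).map ((↑) : ℝ → ℂ) = 0 := by ext i j; simp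
  have hM' : ν / (4 * π ^ 2) * (⟪pC, meanFeedback W₁ (ν • S) 1 (R0 ν) j j' qC⟫_ℂ).re -
      (⟪pC, Matrix.toEuclideanCLM (n := Fin 3) (𝕜 := ℂ) ((freshMat S j j').map ((↑) : ℝ → ℂ)) qC⟫_ℂ).re =
      ν / (4 * π ^ 2) * (⟪pC, (1 / W₁.period) • ∫ t in s..s + L, feedback W₁ (R0 ν) j t (N t qC)⟫_ℂ).re := by
    rw [hM, hfresh, h0, map_zero, _root_.zero_apply, inner_zero_right, Complex.zero_re, sub_zero]
  have hpt' : ∀ t ∈ Set.uIoc s (s + L), ‖⟪pC, feedback W₁ (R0 ν) j t (N t qC)⟫_ℂ‖ ≤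
      1 / (2 * ‖latticeVec (cubatureWord.phase j).m‖) * ‖transversalProj (cubatureWord.phase j).m pC‖ *
        (2 * (ε * (8 * π * ‖slotAmp W₁ j'‖ / min (1:ℝ) (4 * π ^ 2 * (ν * (10 / 11))) * ‖transversalProj (cubatureWord.phase j').m qC‖))) := by
    intro t ht; have h := hpt t ht; rw [hC, hSUP, hr] at h; exact h
  exact tail_bound_of_decomp_eps ⟨hν0, hν40⟩ S p q j j' ε _ hXint hM' hpt'

/-! ## §2 No fresh part off the diagonal and the forward pairs -/




/-! ## §3 The ZERO class, crushed -/

set_option maxHeartbeats 400000 in -- pre-budgeted (ops-buildfix rule): large statement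
/-- **THE ZERO CLASS, CRUSHED.**  Pickup `j ≠ j'` with `mⱼ ∦ m_{j'}` (a nonzero `2×2` minor), no fresh part, and every slot cyclically strictly between `j'` and `j`
STATIC for `m_{j'}` (`v_l·m_{j'} = 0`).  Then ν-free `C > 0`, `r₁ ∈ (0, 1/4]` with `|tailKernel ν S p q j j'| ≤ C·√ν·gTail j j'·(√PpSq_j(p)·√PpSq_{j'}(q))` for
`ν = r³ ≤ r₁³` and every block-window background: the read fibres `± mⱼ` avoid the source ladders `± m_{j'} + ℤmⱼ`, so the pickup sees only the old memory,
which is the CRUSHED OLD STATE of slot `j'`. [cite: ArmstrongVicol2025, §3] [cite: BedrossianCotiZelati2017, §2] [cite: SandersVerhulstMurdock2007, Lemma 5.2.7] -/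
theorem tail_bound_zero_class_eps {j j' : Fin 26} (hne : j ≠ j')
    (hnc : (slots j).m 0 * (slots j').m 1 - (slots j).m 1 * (slots j').m 0 ≠ 0 ∨ (slots j).m 0 * (slots j').m 2 - (slots j).m 2 * (slots j').m 0 ≠ 0 ∨
      (slots j).m 1 * (slots j').m 2 - (slots j).m 2 * (slots j').m 1 ≠ 0)
    (hstat : ∀ l : Fin 26, l ≠ j' → ((j' < l ∧ l < j) ∨ (j < j' ∧ (j' < l ∨ l < j))) →
      (slots l).v 0 * (slots j').m 0 + (slots l).v 1 * (slots j').m 1 + (slots l).v 2 * (slots j').m 2 = 0) :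
    ∃ C r₁ : ℝ, 0 < C ∧ 0 < r₁ ∧ r₁ ≤ 1 / 4 ∧ ∀ {r : ℝ} (hr : 0 < r), r ≤ r₁ →
      ∀ {S : T4}, Torus.NearIso S (10 / 11) (11 / 10) → ∀ τ ∈ Icc (0:ℝ) (1 / 20), OddSectorial S τ → freshMat S j j' = 0 → ∀ p q : Fin 3 → ℝ,
      |tailKernel (r ^ 3) S p q j j'| ≤ C * Real.sqrt (r ^ 3) * (gTail j j' * (Real.sqrt (PpSq j p) * Real.sqrt (PpSq j' q))) := by
  obtain ⟨C, r₁, hC, hr₁, hr₁4, hold⟩ := crushed_old_state j'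
  refine ⟨C * Real.exp θmin, r₁, by positivity, hr₁, hr₁4, ?_⟩
  intro r hr hr1 S hS τ hτw hodd hfresh p q
  have hν0 : 0 < r ^ 3 := pow_pos hr 3
  have hν40 : r ^ 3 ≤ 1 / 40 := by
    have h := pow_le_pow_left₀ hr.le (hr1.trans hr₁4) 3
    linarith [show ((1:ℝ) / 4) ^ 3 ≤ 1 / 40 by norm_num]
  set W₁ := (cubatureWord.stretch MB MB_pos).stretch (1 / r ^ 3) (one_div_pos.mpr hν0) with hW₁
  set qC : EuclideanSpace ℂ (Fin 3) := WithLp.toLp 2 fun i => ((q i : ℝ) : ℂ) with hqC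
  have h𝔸 : Torus.NearIso (r ^ 3 • S) (r ^ 3 * (10 / 11)) (r ^ 3 * (11 / 10)) := hS.smul hν0.le
  have hlo : (0:ℝ) < r ^ 3 * (10 / 11) := by positivity
  -- the read fibres avoid the source ladders
  have hmnc : ∀ c : ℤ, (W₁.phase j').m ≠ c • (W₁.phase j).m := ne_smul_of_minor_ne_zero hnc
  obtain ⟨hwp, hwm⟩ := not_mem_ladders_of_not_colinear hmnc
  -- static links between the source and the pickup, in complex form
  have hstatC : ∀ l : Fin 26, l ≠ j' → ((j' < l ∧ l < j) ∨ (j < j' ∧ (j' < l ∨ l < j))) →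
      ∑ a, ((W₁.phase l).e a : ℂ) * ((W₁.phase j').m a : ℂ) = 0 :=
    fun l hl h => sum_e_mul_eq_zero_of_vdot_complex (hstat l hl h)
  -- only slot `j` on its closed window; the source of `j'` is off there
  have hoff : ∀ t ∈ Icc (W₁.start j) (W₁.start j + (W₁.phase j).τ), ∀ l, l ≠ j → slotEnvelope W₁ l t = 0 :=
    fun t ht l hl => slotEnvelope_eq_zero_of_mem_slot_Icc W₁ hl ht
  have hsrcw : ∀ t ∈ Icc (W₁.start j) (W₁.start j + (W₁.phase j).τ), slotEnvelope W₁ j' t = 0 :=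
    fun t ht => slotEnvelope_eq_zero_of_mem_slot_Icc W₁ hne.symm ht
  -- the crushed old state of the source slot
  have hcr := hold hr hr1 hS τ hτw hodd qC
  -- the two read coordinates along the pickup slot are bounded by the old state at the source start
  have hcoord : ∀ t ∈ Icc (W₁.start j) (W₁.start j + (W₁.phase j).τ), ∀ {w : Fin 3 → ℤ},
      w ∉ ladder (W₁.phase j').m (W₁.phase j).m ∪ ladder (-(W₁.phase j').m) (W₁.phase j).m →
      ‖coordL (R0 (r ^ 3)) w (responseExt W₁ (r ^ 3 • S) 1 (R0 (r ^ 3)) j' t qC)‖ ≤ ‖responseExt W₁ (r ^ 3 • S) 1 (R0 (r ^ 3)) j' (W₁.start j') qC‖ := by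
    intro t ht w hw
    rcases lt_or_gt_of_ne hne with hlt | hgt
    · -- `j < j'`: the source window one period earlier
      have h := norm_coordL_responseExt_le_of_static W₁ h𝔸 hlo one_pos (R0 (r ^ 3)) j' j qC (window_of_gt W₁ hlt).1
        (hstatic_of_gt W₁ hlt (fun l hl' => hstatC l (hl'.elim (fun h => ne_of_gt h) (fun h => ne_of_lt (h.trans hlt))) (Or.inr ⟨hlt, hl'⟩))
          (R0 (r ^ 3))) hsrcw hoff hw t ht
      have hper : responseExt W₁ (r ^ 3 • S) 1 (R0 (r ^ 3)) j' (W₁.start j' - W₁.period) qC =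
          responseExt W₁ (r ^ 3 • S) 1 (R0 (r ^ 3)) j' (W₁.start j') qC := by
        rw [← responseExt_add_period W₁ (r ^ 3 • S) 1 (R0 (r ^ 3)) j' (W₁.start j' - W₁.period), sub_add_cancel]
      rw [hper] at h
      exact h
    · -- `j' < j`: same period
      exact norm_coordL_responseExt_le_of_static W₁ h𝔸 hlo one_pos (R0 (r ^ 3)) j' j qC (window_of_lt W₁ hgt).1
        (hstatic_of_lt W₁ (fun l h1 h2 => hstatC l (ne_of_gt h1) (Or.inl ⟨h1, h2⟩)) (R0 (r ^ 3))) hsrcw hoff hw t ht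
  have hfin := tail_bound_far_core_eps' ⟨hν0, hν40⟩ hS p q hfresh (C * Real.sqrt (r ^ 3))
    (fun t ht => ⟨(hcoord t ht hwm).trans hcr, (hcoord t ht hwp).trans hcr⟩)
  calc |tailKernel (r ^ 3) S p q j j'| ≤ C * Real.sqrt (r ^ 3) * Real.exp θmin * gTail j j' * (Real.sqrt (PpSq j p) * Real.sqrt (PpSq j' q)) := hfin
    _ = C * Real.exp θmin * Real.sqrt (r ^ 3) * (gTail j j' * (Real.sqrt (PpSq j p) * Real.sqrt (PpSq j' q))) := by ring

end Summit.AnomalousDissipation.AnomalousDissipation.Theorems.SolenoidalFractalHomogenisation.LagrangianStep.D1Tail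

end
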